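import Summits.BirchSwinnertonDyer.BirchSwinnertonDyer.Theorems.BiquadraticEisensteinDescentHeegnerTwistCouplingInSupplySymbolicMonskyMuOneDesign
import Summits.BirchSwinnertonDyer.BirchSwinnertonDyer.Theorems.BiquadraticEisensteinDescentHeegnerTwistCouplingInSupplySymbolicMonskyClosureSymb
import HarnessLib

set_option linter.dupNamespace false -- `Summit.BirchSwinnertonDyer.BirchSwinnertonDyer.Theorems.…` (summit = sub)
set_option autoImplicit false

/-!
# Crux `HeegnerTwistCouplingInSupply` (stmt-BirchSwinnertonDyer-21381) — ★★★ THEOREM B: UNIFORM EXISTENCE of pattern-free Heegner recipes for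
# EVERY base with exactly one prime `≡ 3 (mod 4)` and `n₀ ≡ 7 (mod 8)` (all `k`, NO hypothesis on the virtual kernel)

Route `BiquadraticEisensteinDescent` (cell `pub/bsd-wall`, width seat `bsd-wall-cm-bed-w3` g23; `--supports` 21381, helper). Capstone of
`…SymbolicMonskyMuOneLaplacian` / `…DesignDual` / `…MuOneDesign`, companion of THEOREM A `…SymbolicMonskyDesignExists.exists_patternFree_design`
(w3 g22: every base whose augmented virtual kernel has dimension `2τ` and meets the three coordinate planes in dimension `≤ τ` — all but the thin
EXCEPTIONAL class `t_pred > t₀`). THEOREM B covers the exceptional class and everything else at once for `μ = 1`: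

★★★ `exists_patternFree_design_muOne`: for ANY `base : SymbData (k+1)` with exactly one `b₀` with `P_(b₀) ≡ 3 (mod 4)` and `Σ_b [(2/P_b) = −1]`
even — i.e. the odd congruent number `n₀ = P₀⋯P_k ≡ 7 (mod 8)` (root number `−1`) with `μ = 1`, e.g. every `n₀ = p·r₁⋯r_k ≡ 7 (8)` with
`p ≡ 3 (4)` and all `r_i ≡ 1 (4)` — there are cells `c₁ :: rest`, `|rest| ≤ k + 1`, with `heegnerK base (c₁ :: rest)` and
`det M_odd(base, c₁ :: rest, pat) = 1` for EVERY mutual pattern `pat`: a PATTERN-FREE HEEGNER RECIPE with at most `k + 2` auxiliary primes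
(in fact `t_pred = κ_u + ε + 1` of memo THEOREM-A-w3g22 §6). `exists_patternFree_design_muOne_of_prod_clsVal`: the same with the hypothesis
`(∏_b clsVal (cls b)) % 8 = 7` (`sum_bz_negTwo_eq_zero_of_prod_clsVal` reads off the `(2/·)`-parity via `prod_clsVal_mod_eight`).
★★★ `exists_recipe_cruxOn_odd_muOne` — THROUGH THE DOOR (`RealisesK.cruxOn_odd_of_BT_of_forall` of `…SymbolicMonskyClosureSymb`): for every such
base with `p = P₀` the prime `≡ 3 (mod 4)` there is ONE cell list `aux` (`|aux| ≤ k + 2`) such that any realising primes `P`, `q` (nothing asked of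
the mutual symbols) with `√(∏q)·log(∏q) < π P₀` give the conclusion of `HeegnerTwistCouplingInSupply` at `(E_(n₀), P₀)` modulo Burungale–Tian.
PROOF: `S = ker L` (a `Submodule`, from `exists_lap_linearMap`), `Z'` a complement (`Submodule.exists_isCompl`); dichotomy (α) some `a₁ ∈ S`,
`(a₁)_(b₀) = 0`, `⟨d, a₁⟩ = 1` → `Z = Z' ⊔ ⟨1 + a₁⟩`, `δ = 0`, `muOne_design_alpha`; (β) otherwise `d ⊥ ker L` (using `|d|` even for the
coset `a + 1`) → `d = Lu` (`exists_lap_eq_of_orthogonal_ker`), `Z = Z'`, `δ = u + 1`, `muOne_design_beta`; the forms are a basis of the dual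
annihilator of `Z` (`exists_dual_family_cutting`, `τ = codim Z ≤ k + 1`).
CONSEQUENCE for the corner layer: together with the located-prime doors (`…PatternFreeDoor`, Linnik censuses) every `E_(n₀)` of this class has a
supply of Heegner fields `ℚ(√−q₁⋯q_t)` with `L(E_(n₀ q₁⋯q_t), 1) ≠ 0`-certificates by `t ≤ k + 2` INDEPENDENT single-prime Chebotarev conditions
(no bilinear condition) — the remaining conjunct of the crux there is `p ∤ h(−q₁⋯q_t)` alone ((H′) of the route text).

HONEST FRAMING: RUNG-LEVEL corner layer (congruent `j = 1728` families `E_(n₀)`); an existence theorem about Monsky matrices — instances of the crux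
still need located primes and the print inputs (Burungale–Tian); `μ ≥ 2` bases are not covered here (THEOREM A covers their non-exceptional part);
the crux as stated (C⁺), its registered stubs and BSD are NOT touched; nothing is closed. THEOREMS ONLY.
Reference: [HeathBrown1994] D. R. Heath-Brown, Invent. Math. 118 (1994) 331–370, appendix (Monsky), typescript p. 39 L27–L33.
-/

namespace Summit.BirchSwinnertonDyer.BirchSwinnertonDyer.Theorems.SymbolicMonsky

section MuOneExists

open Matrix Module

variable {k : ℕ} (base : SymbData (k + 1))

/-- `(List.ofFn g).getD i dflt = g i`. -/
private theorem getD_ofFn₃ {α : Type*} {n : ℕ} (g : Fin n → α) (dflt : α) (i : ℕ) (hi : i < n) :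
    (List.ofFn g).getD i dflt = g ⟨i, hi⟩ := by
  rw [List.getD_eq_getElem?_getD, List.getElem?_ofFn]
  simp [hi]

/-- `n₀ ≡ 7 (mod 8)` on the classes: if the classes of the base primes multiply to `7 (mod 8)` then an even number of them is `≡ ±3 (mod 8)`
(`(2/n₀) = +1`). -/
theorem sum_bz_negTwo_eq_zero_of_prod_clsVal (h7 : (∏ b, clsVal (base.cls b)) % 8 = 7) :
    (∑ b, bz (negTwo (base.cls b))) = 0 := by
  classical
  set l : List AuxCell := List.ofFn fun b : Fin (k + 1) => (base.cls b, 0) with hl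
  have hlen : l.length = k + 1 := List.length_ofFn
  have hprod : (l.map fun c => clsVal c.1).prod = ∏ b, clsVal (base.cls b) := by
    rw [hl, List.map_ofFn, List.prod_ofFn]; rfl
  have h8 := prod_clsVal_mod_eight l
  rw [hprod, h7] at h8
  have hD : xorFold l (fun c => negTwo c.1) = false := by
    generalize xorFold l (fun c => negNegOne c.1) = M at h8
    generalize xorFold l (fun c => negTwo c.1) = D at h8
    cases M <;> cases D <;> first | rfl | (revert h8; decide)
  have hsum : (∑ i : Fin l.length, bz (negTwo (l.getD i.val (0, 0)).1)) = bz (xorFold l fun c => negTwo c.1) :=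
    sum_bz_getD_eq_xorFold l (fun c => negTwo c.1)
  set e : Fin l.length ≃ Fin (k + 1) := finCongr hlen with he
  have hget : ∀ (j : ℕ) (hj : j < k + 1), l.getD j (0, 0) = (base.cls ⟨j, hj⟩, 0) := fun j hj =>
    getD_ofFn₃ (fun b : Fin (k + 1) => (base.cls b, (0 : ℕ))) (0, 0) j hj
  have hre : (∑ i : Fin l.length, bz (negTwo (l.getD i.val (0, 0)).1)) = ∑ b, bz (negTwo (base.cls b)) := by
    refine Fintype.sum_equiv e _ _ (fun i => ?_)
    rw [hget i.val (lt_of_lt_of_eq i.isLt hlen)]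
    rfl
  rw [← hre, hsum, hD]
  rfl

/-- ★★★ **THEOREM B — UNIFORM EXISTENCE OF PATTERN-FREE HEEGNER RECIPES FOR EVERY `μ = 1` BASE.** Let `base : SymbData (k+1)` be ANY
base datum with exactly one base prime `P_(b₀) ≡ 3 (mod 4)` and an even number of base primes `≡ ±3 (mod 8)` (equivalently: the odd
congruent number `n₀ = P₀⋯P_k` is `≡ 7 (mod 8)` with exactly one prime factor `≡ 3 (mod 4)` — the root-number-`−1` class with `μ = 1`,
e.g. every `n₀ = p r₁⋯r_k` with `p ≡ 3 (4)`, all `r_i ≡ 1 (4)`, `n₀ ≡ 7 (8)`). THEN a pattern-free Heegner recipe EXISTS: free cells `rest`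
(`|rest| ≤ k + 1`, primes `≡ 1 (mod 4)` with prescribed symbols against the base) and the Heegner-forced cell `c₁` with
`heegnerK base (c₁ :: rest)` and Monsky's odd matrix of `(base, c₁ :: rest, pat)` invertible for EVERY mutual pattern `pat`.
NO hypothesis on the virtual kernel (contrast THEOREM A `exists_patternFree_design`, which needs `dim 𝒦⁺ = 2τ` and three bounds and misses
the exceptional class): for `μ = 1` the Laplacian is symmetric, `𝒦 = {(u,w) : u ∈ V₀, w ∈ ker L, Lu = D_d w}`, `ker L = A ⊕ ⟨1⟩`, and the
design is `Z = Z′ ⊕ ⟨1 + a₁⟩` (`⟨d, a₁⟩ = 1`, case α, `τ = dim A`) or `Z = Z′` a complement of `ker L` with `δ = u_d + 1`, `L u_d = d`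
(case β, `τ = dim A + 1`), certified by the two-stage criterion `design_recipe_of_stages` (`muOne_design_alpha` / `muOne_design_beta`).
The number of auxiliary primes is `τ + 1 = κ_u + ε + 1 = t_pred` (memo THEOREM-A-w3g22 §6; numerics: 760 bases `K ≤ 7`, 0 failures).
HONEST FRAMING: RUNG-LEVEL corner layer (congruent `j = 1728` families); instances of the crux still need located primes and the print
inputs; the crux (C⁺), its registered stubs and BSD are NOT touched; nothing is closed.
[cite: HeathBrown1994SelmerCongruentII, Appendix (Monsky), typescript p. 39 L27–L33] -/
theorem exists_patternFree_design_muOne (b₀ : Fin (k + 1)) (hμ : ∀ b, negNegOne (base.cls b) = true ↔ b = b₀)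
    (hd : (∑ b, bz (negTwo (base.cls b))) = 0) :
    ∃ (c₁ : AuxCell) (rest : List AuxCell), rest.length ≤ k + 1 ∧ heegnerK base (c₁ :: rest) = true ∧
      ∀ pat : ℕ → ℕ → Bool, (dataK base (c₁ :: rest) pat).monskyOddS.det = 1 := by
  classical
  -- packaging: a recipe with `τ ≤ k + 1` free cells is a witness
  have finish : ∀ τ : ℕ, τ ≤ k + 1 → (∃ (c₁ : AuxCell) (rest : List AuxCell), rest.length = τ ∧ heegnerK base (c₁ :: rest) = true ∧
      ∀ pat : ℕ → ℕ → Bool, (dataK base (c₁ :: rest) pat).monskyOddS.det = 1) →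
      ∃ (c₁ : AuxCell) (rest : List AuxCell), rest.length ≤ k + 1 ∧ heegnerK base (c₁ :: rest) = true ∧
        ∀ pat : ℕ → ℕ → Bool, (dataK base (c₁ :: rest) pat).monskyOddS.det = 1 := by
    rintro τ hτ ⟨c₁, rest, hlen, hH, hdet⟩
    exact ⟨c₁, rest, hlen.le.trans hτ, hH, hdet⟩
  obtain ⟨L, hL⟩ := exists_lap_linearMap base
  set S : Submodule (ZMod 2) (Fin (k + 1) → ZMod 2) := LinearMap.ker L with hSdef
  have hmemS : ∀ v : Fin (k + 1) → ZMod 2, v ∈ S ↔ ∀ b, (∑ b', bz (base.neg b b') * (v b' + v b)) = 0 := by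
    intro v
    rw [hSdef, LinearMap.mem_ker]
    constructor
    · intro h b; rw [← hL]; exact congrFun h b
    · intro h; funext b; rw [hL]; exact h b
  have one_mem : (fun _ => (1 : ZMod 2)) ∈ S := (hmemS _).2 fun b => lap_const base 1 b
  have hfinV : finrank (ZMod 2) (Fin (k + 1) → ZMod 2) = k + 1 := by
    rw [Module.finrank_fintype_fun_eq_card, Fintype.card_fin]
  obtain ⟨Z', hZ'⟩ := Submodule.exists_isCompl S
  have hsplit : ∀ v : Fin (k + 1) → ZMod 2, ∃ s ∈ S, ∃ z ∈ Z', s + z = v := fun v => by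
    have hv : v ∈ S ⊔ Z' := by rw [hZ'.sup_eq_top]; exact Submodule.mem_top
    exact Submodule.mem_sup.1 hv
  have hdisj : ∀ z, z ∈ S → z ∈ Z' → z = 0 := fun z hzS hzZ => (Submodule.disjoint_def.1 hZ'.disjoint) z hzS hzZ
  by_cases hα : ∃ a₁ : Fin (k + 1) → ZMod 2, (∀ b, (∑ b', bz (base.neg b b') * (a₁ b' + a₁ b)) = 0) ∧ a₁ b₀ = 0 ∧
      (∑ b, bz (negTwo (base.cls b)) * a₁ b) = 1
  · -- case (α): Z = Z' ⊕ ⟨1 + a₁⟩, δ = 0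
    obtain ⟨a₁, ha₁S, ha₁0, hda₁⟩ := hα
    set z₁ : Fin (k + 1) → ZMod 2 := fun b => 1 + a₁ b with hz₁def
    have hz₁S : z₁ ∈ S := by
      have : z₁ = (fun _ => (1 : ZMod 2)) + a₁ := by funext b; simp [hz₁def]
      rw [this]; exact S.add_mem one_mem ((hmemS a₁).2 ha₁S)
    set Z : Submodule (ZMod 2) (Fin (k + 1) → ZMod 2) := Z' ⊔ Submodule.span (ZMod 2) {z₁} with hZdef
    have hz₁Z : z₁ ∈ Z := Submodule.mem_sup_right (Submodule.mem_span_singleton_self z₁)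
    obtain ⟨τ, f, hτ, hind, hfZ⟩ := exists_dual_family_cutting Z
    have hτle : τ ≤ k + 1 := by have := Submodule.finrank_le Z; omega
    refine finish τ hτle (muOne_design_alpha base b₀ hμ hd τ f 0 a₁ hind ha₁S ha₁0 hda₁ (fun i => (hfZ z₁).2 hz₁Z i) ?_ ?_)
    · -- Z ∩ ker L ⊆ {0, z₁}
      intro z hfz hLz
      have hzZ : z ∈ Z := (hfZ z).1 hfz
      have hzS : z ∈ S := (hmemS z).2 hLz
      rw [hZdef, Submodule.mem_sup] at hzZ
      obtain ⟨z', hz', w, hw, rfl⟩ := hzZ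
      rw [Submodule.mem_span_singleton] at hw
      obtain ⟨c, rfl⟩ := hw
      have hz'S : z' ∈ S := by
        have := S.sub_mem hzS (S.smul_mem c hz₁S)
        simpa using this
      have hz'0 : z' = 0 := hdisj z' hz'S hz'
      rcases zmod_two_eq_zero_or_eq_one c with hc | hc
      · left; rw [hz'0, hc, zero_smul, zero_add]
      · right; rw [hz'0, hc, one_smul, zero_add]
    · -- a form killing A and Z is zero (A + Z ⊇ A + ⟨z₁⟩ + Z' = S + Z' = V)
      intro φ hφA hφZ
      apply LinearMap.ext
      intro v
      obtain ⟨s, hs, z', hz', rfl⟩ := hsplit v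
      have hφz' : φ z' = 0 := hφZ z' ((hfZ z').2 (Submodule.mem_sup_left hz'))
      have hφz₁ : φ z₁ = 0 := hφZ z₁ ((hfZ z₁).2 hz₁Z)
      have hφs : φ s = 0 := by
        rcases zmod_two_eq_zero_or_eq_one (s b₀) with h0 | h1
        · exact hφA s ((hmemS s).1 hs) h0
        · have h' : φ (s + z₁) = 0 :=
            hφA (s + z₁) ((hmemS _).1 (S.add_mem hs hz₁S)) (by
              show s b₀ + (1 + a₁ b₀) = 0
              rw [h1, ha₁0]; decide)
          rw [map_add, hφz₁, add_zero] at h'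
          exact h'
      rw [LinearMap.zero_apply, map_add, hφs, hφz', add_zero]
  · -- case (β): d ⊥ ker L, d = L u, Z = Z', δ = u + 1
    have hdA : ∀ a : Fin (k + 1) → ZMod 2, (∀ b, (∑ b', bz (base.neg b b') * (a b' + a b)) = 0) → a b₀ = 0 →
        (∑ b, bz (negTwo (base.cls b)) * a b) = 0 := by
      intro a ha ha0
      rcases zmod_two_eq_zero_or_eq_one (∑ b, bz (negTwo (base.cls b)) * a b) with h | h
      · exact h
      · exact absurd ⟨a, ha, ha0, h⟩ hα
    have hdS : ∀ v : Fin (k + 1) → ZMod 2, (∀ b, (∑ b', bz (base.neg b b') * (v b' + v b)) = 0) →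
        (∑ b, bz (negTwo (base.cls b)) * v b) = 0 := by
      intro v hv
      rcases zmod_two_eq_zero_or_eq_one (v b₀) with h0 | h1
      · exact hdA v hv h0
      · have hv' : ∀ b, (∑ b', bz (base.neg b b') * ((v b' + 1) + (v b + 1))) = 0 := fun b => by
          rw [lap_add_const base v 1 b]; exact hv b
        have h' := hdA (fun b => v b + 1) hv' (by show v b₀ + 1 = 0; rw [h1]; decide)
        have : (∑ b, bz (negTwo (base.cls b)) * (v b + 1)) = (∑ b, bz (negTwo (base.cls b)) * v b) + ∑ b, bz (negTwo (base.cls b)) := by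
          rw [← Finset.sum_add_distrib]; exact Finset.sum_congr rfl fun b _ => by ring
        rw [this, hd, add_zero] at h'
        exact h'
    obtain ⟨u, hu0, hu⟩ := exists_lap_eq_of_orthogonal_ker base b₀ hμ (fun b => bz (negTwo (base.cls b))) hdS
    obtain ⟨τ, f, hτ, hind, hfZ⟩ := exists_dual_family_cutting Z'
    have hτle : τ ≤ k + 1 := by have := Submodule.finrank_le Z'; omega
    refine finish τ hτle (muOne_design_beta base b₀ hμ τ f u hind hu hu0 ?_ ?_)
    · intro z hfz hLz
      exact hdisj z ((hmemS z).2 hLz) ((hfZ z).1 hfz)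
    · intro φ hφS hφZ
      apply LinearMap.ext
      intro v
      obtain ⟨s, hs, z', hz', rfl⟩ := hsplit v
      rw [LinearMap.zero_apply, map_add, hφS s ((hmemS s).1 hs), hφZ z' ((hfZ z').2 hz'), add_zero]

/-- ★★★ **THEOREM B in congruent-number language.** Same statement with the hypotheses read on `n₀ = P₀ ⋯ P_k`: the classes of the base
primes multiply to `7 (mod 8)` (root number `−1` for odd `n₀` with `μ` odd) and exactly one of them is `3 (mod 4)` (`μ = 1`).
[cite: HeathBrown1994SelmerCongruentII, Appendix (Monsky), typescript p. 39 L27–L33] -/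
theorem exists_patternFree_design_muOne_of_prod_clsVal (b₀ : Fin (k + 1))
    (hμ : ∀ b, negNegOne (base.cls b) = true ↔ b = b₀) (h7 : (∏ b, clsVal (base.cls b)) % 8 = 7) :
    ∃ (c₁ : AuxCell) (rest : List AuxCell), rest.length ≤ k + 1 ∧ heegnerK base (c₁ :: rest) = true ∧
      ∀ pat : ℕ → ℕ → Bool, (dataK base (c₁ :: rest) pat).monskyOddS.det = 1 :=
  exists_patternFree_design_muOne base b₀ hμ (sum_bz_negTwo_eq_zero_of_prod_clsVal base h7)

end MuOneExists

section MuOneDoor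

open Matrix Module Literature.NumberTheory.EllipticCurves Literature.NumberTheory.EllipticCurves.HeathBrown1994
  Literature.NumberTheory.EllipticCurves.HeathBrown1994.Families
open Literature.NumberTheory.EllipticCurves.Rank1Residual

variable {k : ℕ} (base : SymbData (k + 1))

/-- ★★★ **THEOREM B THROUGH THE DOOR: a uniform recipe for the crux conclusion on every `E_(n₀)`, `n₀ ≡ 7 (mod 8)` odd with exactly one prime
factor `p = P₀ ≡ 3 (mod 4)` (the CM-inert bad prime), modulo Burungale–Tian.** For every such base datum there is ONE auxiliary cell list `aux`
(`1 ≤ |aux| ≤ k + 2`, Heegner check passed) such that ANY primes `P` realising the base and ANY auxiliary primes `q` realising the cells — distinct,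
in the prescribed classes mod `8`, with the prescribed symbols `(q_i/P_b)`, NOTHING asked of the mutual symbols `(q_j/q_i)` — with
`√(∏q)·log(∏q) < π·P₀` yield an imaginary quadratic `K′ = ℚ(√−q₁⋯q_t)`, `|d_K′| > 4`, Heegner for `N(E_(n₀))`, with `L(E_(n₀)^(d_K′), 1) ≠ 0`
and `P₀ ∤ h(K′)` — the conclusion of `HeegnerTwistCouplingInSupply` at `(E_(n₀), P₀)`. (`exists_patternFree_design_muOne_of_prod_clsVal` fed
through `RealisesK.cruxOn_odd_of_BT_of_forall`.) The supply of such `q` is `|aux|` INDEPENDENT single-prime Chebotarev conditions plus the size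
window; locating them (Linnik censuses `…LinnikCensusSlot/K`) and the print input (Burungale–Tian) are NOT provided here; the crux as stated (C⁺),
its registered stubs and BSD are NOT touched; nothing is closed.
[cite: HeathBrown1994SelmerCongruentII, Appendix (Monsky), typescript p. 39 L27–L33] [cite: BurungaleTian2026, Thm. 1.1]
[cite: Oesterle1988Gauss, II §3 Proposition p. 57 (27)] -/
theorem exists_recipe_cruxOn_odd_muOne (hBT : burungaleTian_analyticRank_eq_zero_of_selmerCorank_eq_zero_of_hasCM)
    (hμ : ∀ b : Fin (k + 1), negNegOne (base.cls b) = true ↔ b = 0) (h7 : (∏ b, clsVal (base.cls b)) % 8 = 7) :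
    ∃ aux : List AuxCell, 0 < aux.length ∧ aux.length ≤ k + 2 ∧ heegnerK base aux = true ∧
      ∀ (P : Fin (k + 1) → ℕ) (q : Fin aux.length → ℕ), RealisesK base aux P q →
        ∀ (n : ℕ) [(congruentNumberCurve n).IsElliptic], (∏ b, P b) = n →
          Real.sqrt ((∏ j, q j : ℕ) : ℝ) * Real.log ((∏ j, q j : ℕ) : ℝ) < Real.pi * P 0 →
          ∃ (K : Type) (_ : Field K) (_ : NumberField K),
            IsImaginaryQuadratic K ∧ 4 < (NumberField.discr K).natAbs ∧
            SatisfiesHeegnerHypothesis ((congruentNumberCurve n).conductorNorm ℤ) K ∧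
            ((congruentNumberCurve n).quadraticTwist (NumberField.discr K : ℚ)).entireLFunction 1 ≠ 0 ∧
            ¬ P 0 ∣ NumberField.classNumber K := by
  obtain ⟨c₁, rest, hlen, hH, hdet⟩ := exists_patternFree_design_muOne_of_prod_clsVal base 0 hμ h7
  refine ⟨c₁ :: rest, by simp, by simp only [List.length_cons]; omega, hH, ?_⟩
  intro P q hR n _ hn hsize
  exact hR.cruxOn_odd_of_BT_of_forall hBT hH hdet hn hsize

end MuOneDoor

end Summit.BirchSwinnertonDyer.BirchSwinnertonDyer.Theorems.SymbolicMonsky
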